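import Mathlib
import Summits.AtomisticToContinuum.HydrodynamicLimit.Theorems.ImplosionDichotomyDenseExcursionCavityODE
import Summits.AtomisticToContinuum.HydrodynamicLimit.Theorems.ImplosionDichotomyDenseExcursionCavityTransportEnergy
import Summits.AtomisticToContinuum.HydrodynamicLimit.Theorems.ImplosionDichotomyDenseExcursionSonicSmoothBranchCk

/-!
# Transport of the resolvent equation on non-characteristic segments, uniformly in `Im Λ` (theorem T4)
# (crux `DenseExcursion`, line `sonic-cavity-renewal`, brick for stub `stub_cavityResolventCk`)

Helper file (`--supports stmt-AtomisticToContinuum-12586`, line lead a2, stub-worker E for `stub_cavityResolventCk`).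
THEOREM T4 of the decomposition of `stub_cavityResolventCk` (registered helper `transport_segment`): for a monatomic
profile and a segment `[a, b]` (`a < b`) on which both characteristic speeds are non-zero (`W + S ≠ 1`, `W − S ≠ 1`),
there is ONE constant `K > 0` (depending on the profile on `[a, b]` only) such that for every `Λ : ℂ` and all `C^∞`
sources `f, g`:

* (existence) for every `x₀` and every datum `(w₀, s₀)` the resolvent equation `Λŵ − linW = f`, `Λŝ − linS = g` has a
  solution on `[a, b]` with `(ŵ, ŝ)(x₀) = (w₀, s₀)`, everywhere differentiable and `C^∞` on `(a, b)` (the affine regular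
  ODE in characteristic variables with the coefficients' argument clamped to `[a, b]`, `exists_affine_solution_two`);
* (a-priori bound, UNIFORM IN `Im Λ`) every differentiable solution on `[a, b]` with `‖f‖ + ‖g‖ ≤ M` there satisfies
  `‖ŵ x‖ + ‖ŝ x‖ ≤ K·e^{K|Re Λ|}·(‖ŵ x₀‖ + ‖ŝ x₀‖ + M)` for all `x, x₀ ∈ [a, b]`.

The bound is the energy inequality `|E′| ≤ (2|Re Λ| + 4β + 1)/c₀·E + 18M²/c₀` for `E = ‖ŵ+3ŝ‖² + ‖ŵ−3ŝ‖²`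
(`char_energy_deriv_bound`: the imaginary part of `Λ` multiplies a REAL principal symbol and drops out of `Re(p̄p′)`)
and the two-sided Grönwall lemma `norm_le_gronwall_two_sided`, with `c₀ = min_{[a,b]} min(|c₊|, |c₋|) > 0` and
`β = sup_{[a,b]}` of the order-zero coefficients (compactness). Uniqueness of the IVP on `[a, b]` is the bound applied to
the difference of two solutions (`M = 0`). The dependence on `Re Λ` is a genuine exponential `e^{(b−a)|Re Λ|/c₀}`: on a
segment inside `x < 0` the two characteristic families propagate in opposite `x`-directions, so an IVP in `x` integrates
one of them against its direction; only `Im Λ` is harmless. Sources: folklore (Grönwall; Hartman Ch. IV Lemma 1.1).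
-/

noncomputable section

open Set Filter
open scoped Topology ContDiff RealInnerProductSpace

namespace Summit.AtomisticToContinuum.HydrodynamicLimit.Theorems.SonicCavityRenewal

open Summit.AtomisticToContinuum.HydrodynamicLimit.Theorems.R2OneModeTwoConditions

/-- EXISTENCE FOR THE RESOLVENT EQUATION ON A NON-CHARACTERISTIC SEGMENT: for `C^∞` profile functions `W, S` with
`W − 1 ± S ≠ 0` on `[a, b]` (`a < b`), `Λ : ℂ`, `C^∞` sources and any `(x₀, w₀, s₀)`, there is a pair `(ŵ, ŝ)`,
differentiable on `ℝ`, `C^∞` on `(a, b)`, with `(ŵ, ŝ)(x₀) = (w₀, s₀)`, solving `Λŵ − linW = f`, `Λŝ − linS = g` on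
`[a, b]` (regular affine ODE in the characteristic variables `ŵ ± 3ŝ`, coefficients clamped to `[a, b]`). [folklore] -/
theorem exists_solution_segment {r : ℝ} {W S : ℝ → ℝ} (hW : ContDiff ℝ ∞ W) (hS : ContDiff ℝ ∞ S) {a b : ℝ}
    (hab : a < b) (hnc : ∀ x ∈ Icc a b, W x - 1 + S x ≠ 0 ∧ W x - 1 - S x ≠ 0) (Λ : ℂ) {f g : ℝ → ℂ}
    (hf : ContDiff ℝ ∞ f) (hg : ContDiff ℝ ∞ g) (x₀ : ℝ) (w₀ s₀ : ℂ) :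
    ∃ ŵ ŝ : ℝ → ℂ, ContDiffOn ℝ ∞ ŵ (Ioo a b) ∧ ContDiffOn ℝ ∞ ŝ (Ioo a b) ∧
      (∀ x, DifferentiableAt ℝ ŵ x ∧ DifferentiableAt ℝ ŝ x) ∧ ŵ x₀ = w₀ ∧ ŝ x₀ = s₀ ∧
      ∀ x ∈ Icc a b, Λ * ŵ x - linW r W S ŵ ŝ x = f x ∧ Λ * ŝ x - linS r W S ŵ ŝ x = g x := by
  have hW' : ContDiff ℝ ∞ (deriv W) := (contDiff_infty_iff_deriv.1 hW).2
  have hS' : ContDiff ℝ ∞ (deriv S) := (contDiff_infty_iff_deriv.1 hS).2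
  -- the eight smooth data of the characteristic form, as opaque functions with defining equations
  obtain ⟨Cp, hCp⟩ : ∃ C : ℝ → ℂ, C = fun x => ((W x - 1 + S x : ℝ) : ℂ) := ⟨_, rfl⟩
  obtain ⟨Cm, hCm⟩ : ∃ C : ℝ → ℂ, C = fun x => ((W x - 1 - S x : ℝ) : ℂ) := ⟨_, rfl⟩
  obtain ⟨Bpp, hBpp⟩ : ∃ B : ℝ → ℂ,
      B = fun x => ((2 / 3 * deriv W x + 2 * W x - r + 2 * deriv S x + 4 * S x : ℝ) : ℂ) := ⟨_, rfl⟩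
  obtain ⟨Bpm, hBpm⟩ : ∃ B : ℝ → ℂ, B = fun x => ((deriv W x / 3 + deriv S x + 2 * S x : ℝ) : ℂ) := ⟨_, rfl⟩
  obtain ⟨Bmp, hBmp⟩ : ∃ B : ℝ → ℂ, B = fun x => ((deriv W x / 3 - deriv S x - 2 * S x : ℝ) : ℂ) := ⟨_, rfl⟩
  obtain ⟨Bmm, hBmm⟩ : ∃ B : ℝ → ℂ,
      B = fun x => ((2 / 3 * deriv W x + 2 * W x - r - 2 * deriv S x - 4 * S x : ℝ) : ℂ) := ⟨_, rfl⟩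
  obtain ⟨σp, hσp⟩ : ∃ s : ℝ → ℂ, s = fun x => f x + 3 * g x := ⟨_, rfl⟩
  obtain ⟨σq, hσq⟩ : ∃ s : ℝ → ℂ, s = fun x => f x - 3 * g x := ⟨_, rfl⟩
  have sCp : ContDiff ℝ ∞ Cp := by
    rw [hCp]; exact Complex.ofRealCLM.contDiff.comp ((hW.sub contDiff_const).add hS)
  have sCm : ContDiff ℝ ∞ Cm := by
    rw [hCm]; exact Complex.ofRealCLM.contDiff.comp ((hW.sub contDiff_const).sub hS)
  have sBpp : ContDiff ℝ ∞ Bpp := by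
    rw [hBpp]
    exact Complex.ofRealCLM.contDiff.comp (((((contDiff_const.mul hW').add (contDiff_const.mul hW)).sub
      contDiff_const).add (contDiff_const.mul hS')).add (contDiff_const.mul hS))
  have sBpm : ContDiff ℝ ∞ Bpm := by
    rw [hBpm]
    exact Complex.ofRealCLM.contDiff.comp (((hW'.div_const 3).add hS').add (contDiff_const.mul hS))
  have sBmp : ContDiff ℝ ∞ Bmp := by
    rw [hBmp]
    exact Complex.ofRealCLM.contDiff.comp (((hW'.div_const 3).sub hS').sub (contDiff_const.mul hS))
  have sBmm : ContDiff ℝ ∞ Bmm := by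
    rw [hBmm]
    exact Complex.ofRealCLM.contDiff.comp (((((contDiff_const.mul hW').add (contDiff_const.mul hW)).sub
      contDiff_const).sub (contDiff_const.mul hS')).sub (contDiff_const.mul hS))
  have sσp : ContDiff ℝ ∞ σp := by rw [hσp]; exact hf.add (contDiff_const.mul hg)
  have sσq : ContDiff ℝ ∞ σq := by rw [hσq]; exact hf.sub (contDiff_const.mul hg)
  have Cp0 : ∀ x ∈ Icc a b, Cp x ≠ 0 := fun x hx => by
    simp only [hCp, ne_eq, Complex.ofReal_eq_zero]; exact (hnc x hx).1
  have Cm0 : ∀ x ∈ Icc a b, Cm x ≠ 0 := fun x hx => by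
    simp only [hCm, ne_eq, Complex.ofReal_eq_zero]; exact (hnc x hx).2
  -- the clamp to `[a, b]` and the clamped coefficients (globally continuous, the true ones on `[a, b]`)
  set κ : ℝ → ℝ := fun t => max a (min t b) with hκ
  have hκc : Continuous κ := continuous_const.max (continuous_id.min continuous_const)
  have hκmem : ∀ t, κ t ∈ Icc a b := fun t =>
    ⟨le_max_left _ _, max_le hab.le (min_le_right _ _)⟩
  have hκid : ∀ t ∈ Icc a b, κ t = t := fun t ht => by
    simp only [hκ, min_eq_left ht.2, max_eq_right ht.1]
  have hU : IsOpen (Ioo a b) := isOpen_Ioo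
  set a₁₁ : ℝ → ℂ := fun t => (Λ - Bpp (κ t)) * (Cp (κ t))⁻¹ with ha₁₁
  set a₁₂ : ℝ → ℂ := fun t => -Bpm (κ t) * (Cp (κ t))⁻¹ with ha₁₂
  set b₁ : ℝ → ℂ := fun t => -σp (κ t) * (Cp (κ t))⁻¹ with hb₁
  set a₂₁ : ℝ → ℂ := fun t => -Bmp (κ t) * (Cm (κ t))⁻¹ with ha₂₁
  set a₂₂ : ℝ → ℂ := fun t => (Λ - Bmm (κ t)) * (Cm (κ t))⁻¹ with ha₂₂
  set b₂ : ℝ → ℂ := fun t => -σq (κ t) * (Cm (κ t))⁻¹ with hb₂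
  have cinvp : Continuous fun t => (Cp (κ t))⁻¹ := (sCp.continuous.comp hκc).inv₀ fun t => Cp0 _ (hκmem t)
  have cinvm : Continuous fun t => (Cm (κ t))⁻¹ := (sCm.continuous.comp hκc).inv₀ fun t => Cm0 _ (hκmem t)
  have ca₁₁ : Continuous a₁₁ := (continuous_const.sub (sBpp.continuous.comp hκc)).mul cinvp
  have ca₁₂ : Continuous a₁₂ := (sBpm.continuous.comp hκc).neg.mul cinvp
  have cb₁ : Continuous b₁ := (sσp.continuous.comp hκc).neg.mul cinvp
  have ca₂₁ : Continuous a₂₁ := (sBmp.continuous.comp hκc).neg.mul cinvm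
  have ca₂₂ : Continuous a₂₂ := (continuous_const.sub (sBmm.continuous.comp hκc)).mul cinvm
  have cb₂ : Continuous b₂ := (sσq.continuous.comp hκc).neg.mul cinvm
  have hIo : ∀ t ∈ Ioo a b, t ∈ Icc a b := fun t ht => Ioo_subset_Icc_self ht
  have sinvp : ContDiffOn ℝ ∞ (fun t => (Cp t)⁻¹) (Ioo a b) := sCp.contDiffOn.inv fun t ht => Cp0 t (hIo t ht)
  have sinvm : ContDiffOn ℝ ∞ (fun t => (Cm t)⁻¹) (Ioo a b) := sCm.contDiffOn.inv fun t ht => Cm0 t (hIo t ht)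
  have sa₁₁ : ContDiffOn ℝ ∞ a₁₁ (Ioo a b) :=
    (((contDiffOn_const (c := Λ)).sub sBpp.contDiffOn).mul sinvp).congr fun t ht => by
      simp only [ha₁₁, hκid t (hIo t ht)]
  have sa₁₂ : ContDiffOn ℝ ∞ a₁₂ (Ioo a b) :=
    (sBpm.contDiffOn.neg.mul sinvp).congr fun t ht => by simp only [ha₁₂, hκid t (hIo t ht)]
  have sb₁ : ContDiffOn ℝ ∞ b₁ (Ioo a b) :=
    (sσp.contDiffOn.neg.mul sinvp).congr fun t ht => by simp only [hb₁, hκid t (hIo t ht)]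
  have sa₂₁ : ContDiffOn ℝ ∞ a₂₁ (Ioo a b) :=
    (sBmp.contDiffOn.neg.mul sinvm).congr fun t ht => by simp only [ha₂₁, hκid t (hIo t ht)]
  have sa₂₂ : ContDiffOn ℝ ∞ a₂₂ (Ioo a b) :=
    (((contDiffOn_const (c := Λ)).sub sBmm.contDiffOn).mul sinvm).congr fun t ht => by
      simp only [ha₂₂, hκid t (hIo t ht)]
  have sb₂ : ContDiffOn ℝ ∞ b₂ (Ioo a b) :=
    (sσq.contDiffOn.neg.mul sinvm).congr fun t ht => by simp only [hb₂, hκid t (hIo t ht)]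
  -- the global `C¹` solution of the clamped characteristic system, smooth on `(a, b)`
  obtain ⟨p, q, hp0, hq0, hpq, hsmooth⟩ := exists_affine_solution_two a₁₁ a₁₂ a₂₁ a₂₂ b₁ b₂ ca₁₁ ca₁₂ ca₂₁ ca₂₂ cb₁ cb₂
    x₀ (w₀ + 3 * s₀) (w₀ - 3 * s₀)
  obtain ⟨sp, sq⟩ := hsmooth _ hU sa₁₁ sa₁₂ sa₂₁ sa₂₂ sb₁ sb₂
  set ŵ₁ : ℝ → ℂ := fun x => (p x + q x) / 2 with hŵ₁
  set ŝ₁ : ℝ → ℂ := fun x => (p x - q x) / 6 with hŝ₁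
  refine ⟨ŵ₁, ŝ₁, (sp.add sq).div_const 2, (sp.sub sq).div_const 6,
    fun x => ⟨(((hpq x).1.add (hpq x).2).div_const 2).differentiableAt,
      (((hpq x).1.sub (hpq x).2).div_const 6).differentiableAt⟩,
    by simp only [hŵ₁, hp0, hq0]; ring, by simp only [hŝ₁, hp0, hq0]; ring, fun x hx => ?_⟩
  obtain ⟨h1, h2⟩ := hpq x
  have hD1 : HasDerivAt ŵ₁ ((_ + _) / 2) x := (h1.add h2).div_const 2
  have hD2 : HasDerivAt ŝ₁ ((_ - _) / 6) x := (h1.sub h2).div_const 6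
  have hinvp : Cp x * (Cp x)⁻¹ = 1 := mul_inv_cancel₀ (Cp0 x hx)
  have hinvm : Cm x * (Cm x)⁻¹ = 1 := mul_inv_cancel₀ (Cm0 x hx)
  refine (lin_iff_char r W S Λ ŵ₁ ŝ₁ (f x) (g x) x).2 ⟨?_, ?_⟩
  · have goal : Cp x * (deriv ŵ₁ x + 3 * deriv ŝ₁ x) =
        (Λ - Bpp x) * (ŵ₁ x + 3 * ŝ₁ x) - Bpm x * (ŵ₁ x - 3 * ŝ₁ x) - σp x := by
      rw [hD1.deriv, hD2.deriv]
      simp only [ha₁₁, ha₁₂, hb₁, hκid x hx, hŵ₁, hŝ₁]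
      linear_combination ((Λ - Bpp x) * p x - Bpm x * q x - σp x) * hinvp
    simp only [hCp, hBpp, hBpm, hσp] at goal
    exact goal
  · have goal : Cm x * (deriv ŵ₁ x - 3 * deriv ŝ₁ x) =
        -Bmp x * (ŵ₁ x + 3 * ŝ₁ x) + (Λ - Bmm x) * (ŵ₁ x - 3 * ŝ₁ x) - σq x := by
      rw [hD1.deriv, hD2.deriv]
      simp only [ha₂₁, ha₂₂, hb₂, hκid x hx, hŵ₁, hŝ₁]
      linear_combination (-Bmp x * p x + (Λ - Bmm x) * q x - σq x) * hinvm
    simp only [hCm, hBmp, hBmm, hσq] at goal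
    exact goal

/-- **Registered helper `transport_segment` (T4): TRANSPORT ON NON-CHARACTERISTIC SEGMENTS, UNIFORMLY IN `Im Λ`.**
For a monatomic profile and `a < b` with `W + S ≠ 1`, `W − S ≠ 1` on `[a, b]` there is `K > 0` such that for all
`Λ : ℂ` and `C^∞` sources `f, g`: (i) the resolvent equation has, through every `(x₀, w₀, s₀)`, a solution on `[a, b]`
which is differentiable on `ℝ` and `C^∞` on `(a, b)`; (ii) every differentiable solution on `[a, b]` with
`‖f‖ + ‖g‖ ≤ M` there obeys `‖ŵ x‖ + ‖ŝ x‖ ≤ K e^{K|Re Λ|}(‖ŵ x₀‖ + ‖ŝ x₀‖ + M)` for all `x, x₀ ∈ [a, b]` (energy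
inequality without `Im Λ` + two-sided Grönwall; see the module docstring). [folklore] -/
theorem transport_segment : ∀ (r : ℝ) (W S : ℝ → ℝ), IsMonatomicProfile r W S → ∀ (a b : ℝ), a < b → (∀ x ∈ Set.Icc a b, W x + S x ≠ 1 ∧ W x - S x ≠ 1) → ∃ K : ℝ, 0 < K ∧ ∀ (Λ : ℂ) (f g : ℝ → ℂ), ContDiff ℝ ∞ f → ContDiff ℝ ∞ g → (∀ (x₀ : ℝ) (w₀ s₀ : ℂ), ∃ ŵ ŝ : ℝ → ℂ, ContDiffOn ℝ ∞ ŵ (Set.Ioo a b) ∧ ContDiffOn ℝ ∞ ŝ (Set.Ioo a b) ∧ (∀ x, DifferentiableAt ℝ ŵ x ∧ DifferentiableAt ℝ ŝ x) ∧ ŵ x₀ = w₀ ∧ ŝ x₀ = s₀ ∧ ∀ x ∈ Set.Icc a b, Λ * ŵ x - linW r W S ŵ ŝ x = f x ∧ Λ * ŝ x - linS r W S ŵ ŝ x = g x) ∧ ∀ (ŵ ŝ : ℝ → ℂ) (M : ℝ), (∀ x ∈ Set.Icc a b, DifferentiableAt ℝ ŵ x ∧ DifferentiableAt ℝ ŝ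 x) → (∀ x ∈ Set.Icc a b, Λ * ŵ x - linW r W S ŵ ŝ x = f x ∧ Λ * ŝ x - linS r W S ŵ ŝ x = g x) → (∀ x ∈ Set.Icc a b, ‖f x‖ + ‖g x‖ ≤ M) → ∀ x₀ ∈ Set.Icc a b, ∀ x ∈ Set.Icc a b, ‖ŵ x‖ + ‖ŝ x‖ ≤ K * Real.exp (K * |Λ.re|) * (‖ŵ x₀‖ + ‖ŝ x₀‖ + M) := by
  intro r W S hP a b hab hnc
  obtain ⟨-, -, hW, hS, -, -⟩ := hP
  have hW' : ContDiff ℝ ∞ (deriv W) := (contDiff_infty_iff_deriv.1 hW).2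
  have hS' : ContDiff ℝ ∞ (deriv S) := (contDiff_infty_iff_deriv.1 hS).2
  have hWc : Continuous W := hW.continuous
  have hSc : Continuous S := hS.continuous
  have hW'c : Continuous (deriv W) := hW'.continuous
  have hS'c : Continuous (deriv S) := hS'.continuous
  have hnc' : ∀ x ∈ Icc a b, W x - 1 + S x ≠ 0 ∧ W x - 1 - S x ≠ 0 := fun x hx =>
    ⟨fun h => (hnc x hx).1 (by linarith), fun h => (hnc x hx).2 (by linarith)⟩
  have hK : IsCompact (Icc a b) := isCompact_Icc
  have hne : (Icc a b).Nonempty := nonempty_Icc.2 hab.le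
  -- `c₀`: a positive lower bound for both characteristic speeds on `[a, b]`
  have ccont : Continuous fun x => min |W x - 1 + S x| |W x - 1 - S x| := by fun_prop
  obtain ⟨xm, hxm, hmin⟩ := hK.exists_isMinOn hne ccont.continuousOn
  set c₀ : ℝ := min |W xm - 1 + S xm| |W xm - 1 - S xm| with hc₀
  have hc₀pos : 0 < c₀ := lt_min (abs_pos.2 (hnc' xm hxm).1) (abs_pos.2 (hnc' xm hxm).2)
  have hc₀le : ∀ x ∈ Icc a b, c₀ ≤ |W x - 1 + S x| ∧ c₀ ≤ |W x - 1 - S x| := fun x hx =>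
    ⟨(hmin hx).trans (min_le_left _ _), (hmin hx).trans (min_le_right _ _)⟩
  -- `β`: a bound for the four order-zero coefficients on `[a, b]`
  have bcont : Continuous fun x => |2 / 3 * deriv W x + 2 * W x - r + 2 * deriv S x + 4 * S x| +
      |deriv W x / 3 + deriv S x + 2 * S x| + |deriv W x / 3 - deriv S x - 2 * S x| +
      |2 / 3 * deriv W x + 2 * W x - r - 2 * deriv S x - 4 * S x| := by fun_prop
  obtain ⟨β, hβ⟩ := hK.exists_bound_of_continuousOn bcont.continuousOn
  have hβ' : ∀ x ∈ Icc a b, |2 / 3 * deriv W x + 2 * W x - r + 2 * deriv S x + 4 * S x| ≤ β ∧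
      |deriv W x / 3 + deriv S x + 2 * S x| ≤ β ∧ |deriv W x / 3 - deriv S x - 2 * S x| ≤ β ∧
      |2 / 3 * deriv W x + 2 * W x - r - 2 * deriv S x - 4 * S x| ≤ β := by
    intro x hx
    have h := hβ x hx
    rw [Real.norm_of_nonneg (by positivity)] at h
    refine ⟨?_, ?_, ?_, ?_⟩ <;>
      linarith [abs_nonneg (2 / 3 * deriv W x + 2 * W x - r + 2 * deriv S x + 4 * S x),
        abs_nonneg (deriv W x / 3 + deriv S x + 2 * S x), abs_nonneg (deriv W x / 3 - deriv S x - 2 * S x),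
        abs_nonneg (2 / 3 * deriv W x + 2 * W x - r - 2 * deriv S x - 4 * S x)]
  have hβ0 : 0 ≤ β := le_trans (abs_nonneg _) (hβ' xm hxm).1
  -- the constant
  set θ : ℝ := (b - a) / c₀ with hθ
  have hθpos : 0 < θ := div_pos (by linarith) hc₀pos
  set K : ℝ := 18 * max 1 θ * Real.exp ((4 * β + 1) * θ) with hKdef
  have hKpos : 0 < K := by positivity
  refine ⟨K, hKpos, fun Λ f g hf hg => ⟨fun x₀ w₀ s₀ => exists_solution_segment hW hS hab hnc' Λ hf hg x₀ w₀ s₀,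
    fun ŵ ŝ M hdiff hsol hM x₀ hx₀ x hx => ?_⟩⟩
  -- the a-priori bound
  have hM0 : 0 ≤ M := le_trans (by positivity) (hM x₀ hx₀)
  set p : ℝ → ℂ := fun y => ŵ y + 3 * ŝ y with hp
  set q : ℝ → ℂ := fun y => ŵ y - 3 * ŝ y with hq
  set E : ℝ → ℝ := fun y => ‖p y‖ ^ 2 + ‖q y‖ ^ 2 with hE
  have hpd : ∀ y ∈ Icc a b, HasDerivAt p (deriv ŵ y + 3 * deriv ŝ y) y ∧
      HasDerivAt q (deriv ŵ y - 3 * deriv ŝ y) y := fun y hy =>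
    ⟨(hdiff y hy).1.hasDerivAt.add ((hdiff y hy).2.hasDerivAt.const_mul 3),
      (hdiff y hy).1.hasDerivAt.sub ((hdiff y hy).2.hasDerivAt.const_mul 3)⟩
  have hEd : ∀ y ∈ Icc a b, HasDerivAt E (2 * ⟪p y, deriv ŵ y + 3 * deriv ŝ y⟫ +
      2 * ⟪q y, deriv ŵ y - 3 * deriv ŝ y⟫) y := fun y hy =>
    (hpd y hy).1.norm_sq.add (hpd y hy).2.norm_sq
  have hEnn : ∀ y, 0 ≤ E y := fun y => by positivity
  have h3 : ‖(3 : ℂ)‖ = 3 := by simp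
  have hσ : ∀ y ∈ Icc a b, ‖f y + 3 * g y‖ ≤ 3 * M ∧ ‖f y - 3 * g y‖ ≤ 3 * M := by
    intro y hy
    have hfg := hM y hy
    have hf0 := norm_nonneg (f y)
    constructor
    · calc ‖f y + 3 * g y‖ ≤ ‖f y‖ + ‖3 * g y‖ := norm_add_le _ _
        _ = ‖f y‖ + 3 * ‖g y‖ := by rw [norm_mul, h3]
        _ ≤ 3 * M := by linarith
    · calc ‖f y - 3 * g y‖ ≤ ‖f y‖ + ‖3 * g y‖ := norm_sub_le _ _
        _ = ‖f y‖ + 3 * ‖g y‖ := by rw [norm_mul, h3]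
        _ ≤ 3 * M := by linarith
  have hEb : ∀ y ∈ Icc a b, ‖2 * ⟪p y, deriv ŵ y + 3 * deriv ŝ y⟫ + 2 * ⟪q y, deriv ŵ y - 3 * deriv ŝ y⟫‖ ≤
      (2 * |Λ.re| + 4 * β + 1) / c₀ * ‖E y‖ + 2 * (3 * M) ^ 2 / c₀ := by
    intro y hy
    obtain ⟨e1, e2⟩ := (lin_iff_char r W S Λ ŵ ŝ (f y) (g y) y).1 (hsol y hy)
    obtain ⟨b1, b2, b3, b4⟩ := hβ' y hy
    have h := char_energy_deriv_bound Λ (p y) (q y) _ _ _ _ _ _ _ _ _ _ c₀ β (3 * M) hc₀pos (hc₀le y hy).1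
      (hc₀le y hy).2 b1 b2 b3 b4 (hσ y hy).1 (hσ y hy).2 e1 e2
    rw [Real.norm_eq_abs, Real.norm_of_nonneg (hEnn y)]
    exact h
  have hKE : 0 ≤ (2 * |Λ.re| + 4 * β + 1) / c₀ := by positivity
  have hεE : 0 ≤ 2 * (3 * M) ^ 2 / c₀ := by positivity
  have gron := norm_le_gronwall_two_sided hKE hεE hx₀ hEd hEb x hx
  rw [Real.norm_of_nonneg (hEnn x), Real.norm_of_nonneg (hEnn x₀)] at gron
  -- the arithmetic
  set A : ℝ := ‖ŵ x₀‖ + ‖ŝ x₀‖ with hA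
  have hA0 : 0 ≤ A := by positivity
  have hEx₀ : E x₀ ≤ 18 * A ^ 2 := by
    have hp₀ : ‖p x₀‖ ≤ 3 * A := by
      calc ‖p x₀‖ ≤ ‖ŵ x₀‖ + ‖3 * ŝ x₀‖ := norm_add_le _ _
        _ = ‖ŵ x₀‖ + 3 * ‖ŝ x₀‖ := by rw [norm_mul, h3]
        _ ≤ 3 * A := by rw [hA]; linarith [norm_nonneg (ŵ x₀)]
    have hq₀ : ‖q x₀‖ ≤ 3 * A := by
      calc ‖q x₀‖ ≤ ‖ŵ x₀‖ + ‖3 * ŝ x₀‖ := norm_sub_le _ _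
        _ = ‖ŵ x₀‖ + 3 * ‖ŝ x₀‖ := by rw [norm_mul, h3]
        _ ≤ 3 * A := by rw [hA]; linarith [norm_nonneg (ŵ x₀)]
    have h1 : ‖p x₀‖ ^ 2 ≤ (3 * A) ^ 2 := pow_le_pow_left₀ (norm_nonneg _) hp₀ 2
    have h2 : ‖q x₀‖ ^ 2 ≤ (3 * A) ^ 2 := pow_le_pow_left₀ (norm_nonneg _) hq₀ 2
    simp only [hE]
    nlinarith
  have hN : (‖ŵ x‖ + ‖ŝ x‖) ^ 2 ≤ E x := by
    have hw : ŵ x = (p x + q x) / 2 := by simp only [hp, hq]; ring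
    have hs : ŝ x = (p x - q x) / 6 := by simp only [hp, hq]; ring
    have h2 : ‖(2 : ℂ)‖ = 2 := by simp
    have h6 : ‖(6 : ℂ)‖ = 6 := by simp
    have hw' : ‖ŵ x‖ ≤ (‖p x‖ + ‖q x‖) / 2 := by
      rw [hw, norm_div, h2]; gcongr; exact norm_add_le _ _
    have hs' : ‖ŝ x‖ ≤ (‖p x‖ + ‖q x‖) / 6 := by
      rw [hs, norm_div, h6]; gcongr; exact norm_sub_le _ _
    have hsum : ‖ŵ x‖ + ‖ŝ x‖ ≤ 2 / 3 * (‖p x‖ + ‖q x‖) := by linarith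
    have h0 : 0 ≤ ‖ŵ x‖ + ‖ŝ x‖ := by positivity
    have hsq := pow_le_pow_left₀ h0 hsum 2
    simp only [hE]
    nlinarith [sq_nonneg (‖p x‖ - ‖q x‖), norm_nonneg (p x), norm_nonneg (q x)]
  have hE' : E x ≤ Real.exp ((2 * |Λ.re| + (4 * β + 1)) * θ) * (18 * A ^ 2 + 18 * M ^ 2 * θ) := by
    have e1 : (2 * |Λ.re| + 4 * β + 1) / c₀ * (b - a) = (2 * |Λ.re| + (4 * β + 1)) * θ := by
      rw [hθ]; ring
    have e2 : 2 * (3 * M) ^ 2 / c₀ * (b - a) = 18 * M ^ 2 * θ := by rw [hθ]; ring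
    rw [e1, e2] at gron
    refine gron.trans (mul_le_mul_of_nonneg_left (by linarith) (Real.exp_pos _).le)
  have := transport_bound_arith (by positivity) hA0 hM0 hθpos (by positivity) (abs_nonneg Λ.re) hN hE'
  simpa only [hKdef, mul_comm (4 * β + 1) θ] using this

end Summit.AtomisticToContinuum.HydrodynamicLimit.Theorems.SonicCavityRenewal

end
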